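import Literature.Probability.LatticeModels.FKIsingTopologicalRectangleCrossing
import HarnessLib

/-!
# The random-walk partition function `Z_Ω[x,y]` of a discrete domain of `ℤ²`
# (Chelkak–Duminil-Copin–Hongler 2016, §3.1; Chelkak 2016, Def. 2.5)

Topic `Literature/Probability/LatticeModels` (family `crit-ising`); companion of
`FKIsingTopologicalRectangleCrossing.lean` (discrete domains of `ℤ²` presented by an edge set `E`, the graph
`DiscreteRect.graph E` on the finite vertex set `DiscreteRect.verts E`, external darts, discrete topological
rectangles `DiscreteRect.IsRect E d₀ n` and their arcs; CDH16 Thm. 1.1 as the named fact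
`fkIsing_topologicalRectangle_crossingBounds`). D. Chelkak, H. Duminil-Copin, C. Hongler, *Crossing
probabilities in topological rectangles for the critical planar FK-Ising model*, Electron. J. Probab. 21
(2016), no. 5 = arXiv:1312.7785, §3.1 (held text `lit read arxiv:1312.7785`, pp. 8–9 of the rendering):

* conductances on the completed graph `Ω̄ = Ω ∪ ∂_ext Ω`: "`w_e := 1` if `e ∈ 𝓔(Ω)`, `2(√2 - 1)` if
  `e ∈ 𝓔_ext(Ω)`. This particular choice of boundary conductances will be important in Section 4.1"
  (the boundary modification trick of Chelkak–Smirnov); masses "`m_x := Σ_{y ∼ x} w_{xy}` (`x ∈ Ω`),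
  `2√2 + 1` (`x ∈ ∂_ext Ω`)";
* "For `x, y ∈ Ω̄`, let `S_Ω(x,y)` denote the set of nearest-neighbor paths `x = γ_0 ∼ γ_1 ∼ … ∼ γ_n = y`
  such that `γ_k ∈ Ω` for all `k = 1, …, n - 1` … Let `Z_Ω[x,y]` be the RW partition function defined by
  (3.1) `Z_Ω[x,y] := Σ_{γ ∈ S_Ω(x,y)} m_y⁻¹ ∏_{k=0}^{n(γ)-1} w_{γ_kγ_{k+1}} / m_{γ_k}`.
  For `X, Y ⊂ Ω̄`, define `Z_Ω[X,Y] := Σ_{x ∈ X, y ∈ Y} Z_Ω[x,y]`";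
* Remark 3.3: for `x ∈ Ω` and a boundary arc `E ⊂ ∂_ext Ω`, "`Z_Ω[x,E] = (2√2 + 1)⁻¹ · ℙ[RW with
  generator Δ_Ω starting from x hits E before ∂_ext Ω ∖ E]`", and "this definition is useful in order to
  have a symmetric notation for `Z_Ω[x,y] = Z_Ω[y,x]`".

This is Definition 2.5 of D. Chelkak, *Robust discrete complex analysis: a toolbox*, Ann. Probab. 44 (2016)
(`Z_Ω(x;y) := Σ_{γ ∈ S_Ω(x;y)} w(γ)`, `w(γ) := ∏_s w_{u_su_{s+1}} / ∏_s μ_{u_s}`), specialised to `ℤ²` with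
CDH16's conductances. These partition functions are the currency of the analytic inputs of the printed
proof of CDH16 Thm. 1.1 (CDH16 Thms. 3.4, 3.7, 3.9 = Chelkak 2016 Thms. 3.5, 5.1 / 7.1 and Prop. 6.6;
CDH16 Props. 4.1, 4.3).

This file gives the DEFINITIONS for vertices of `Ω` (the case needed by CDH16 Thm. 3.9 and §4): the
constants `DiscreteRect.wExt = 2(√2 - 1)`, `DiscreteRect.mExt = 2√2 + 1`, the mass `DiscreteRect.mass E x`
(sum over the four lattice directions at `x` of `1` for an edge of `E` and `w_ext` otherwise — for `x ∈ Ω`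
the missing directions are exactly its external edges), the path weight `DiscreteRect.walkWeight E p =
∏_{u ∈ p} m_u⁻¹` of a walk `p` of `DiscreteRect.graph E` (all edges of `𝓔(Ω)` have conductance `1`, so
`m_y⁻¹ ∏_{k<n} w/m_{γ_k} = ∏_{k ≤ n} m_{γ_k}⁻¹`), the partition function `DiscreteRect.rwZ E x y =
Σ' p, w(p)` (an `ℝ≥0∞`-valued sum over ALL walks from `x` to `y` — the paths of `S_Ω(x,y)` for
`x, y ∈ Ω`) and `DiscreteRect.rwZSets E X Y = Σ_{x ∈ X, y ∈ Y} Z_Ω[x,y]`, with the elementary API: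
`4 w_ext ≤ m_x ≤ 4`, positivity, `m_x = 4 w_ext + (1 - w_ext) deg_x`, reversal invariance of weights and
the symmetry `Z_Ω[x,y] = Z_Ω[y,x]`, `Z_Ω[x,x] ≥ 1/4`, `Z_Ω[X,Y]` as a finite double sum. External
endpoints `x_ext ∈ ∂_ext Ω` — needed for CDH16 Thms. 3.4, 3.7 — enter through the first/last external edge
only (`Z_Ω[x_ext, y] = (w_ext/m_ext) Z_Ω[x,y]`): `DiscreteRect.rwZbar E u v` on the vertex type
`Site 2 ⊕ (Site 2 × Fin 4)` of the completed graph `Ω̄` (lattice vertices and one external vertex per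
external dart, as in `DiscreteExtremalLengthExternalArcs.lean`) and `DiscreteRect.rwZbarSets`, with the
reduction lemmas to `rwZ` and the symmetry `rwZbar_comm`. No named facts.

Mathlib anchors: `SimpleGraph.Walk`, `SimpleGraph.Walk.support`, `SimpleGraph.Walk.reverse`, `tsum` on
`ℝ≥0∞` (`ENNReal.le_tsum`, `Function.Injective.tsum_eq`, `tsum_subtype`, `tsum_fintype`). Mathlib has
random walks on graphs neither as Markov chains nor as path sums.

## References
* [ChelkakDuminilCopinHongler2016] D. Chelkak, H. Duminil-Copin, C. Hongler, EJP 21 (2016) no. 5, §3.1,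
  display (3.1), Remark 3.3.
* [Chelkak2016] D. Chelkak, *Robust discrete complex analysis: a toolbox*, Ann. Probab. 44 (2016),
  Def. 2.5 (partition function of the random walk in a discrete domain), §2.3.
-/

noncomputable section

open scoped ENNReal

namespace Literature.Probability.LatticeModels

namespace DiscreteRect

open SimpleGraph Finset

variable {E : Finset (Sym2 (Site 2))}

/-- CDH16's conductance `w_e := 2(√2 - 1)` of the external edges `x x_ext ∈ 𝓔_ext(Ω)` of a discrete
domain (the edges of `𝓔(Ω)` have conductance `1`). [cite: ChelkakDuminilCopinHongler2016, §3.1] -/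
def wExt : ℝ := 2 * (Real.sqrt 2 - 1)

/-- CDH16's mass `m_x := 2√2 + 1 = 2(√2 - 1) + 3` of an external vertex `x ∈ ∂_ext Ω` ("introduced to fit
definitions in [Che12]"). [cite: ChelkakDuminilCopinHongler2016, §3.1] -/
def mExt : ℝ := 2 * Real.sqrt 2 + 1

/-- The mass `m_x := Σ_{y ∼ x} w_{xy}` (CDH16 §3.1) of a lattice point `x` with respect to the discrete
domain with edge set `E`: each of the four lattice directions at `x` contributes the conductance `1` of an
edge of `𝓔(Ω)` or else the conductance `w_ext = 2(√2 - 1)` of an external edge (for `x ∈ Ω` every lattice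
direction missing from `E` is an external dart `DiscreteRect.IsExtDart E (x, k)`, i.e. an external edge
`x x_ext` of `Ω̄`). [cite: ChelkakDuminilCopinHongler2016, §3.1] -/
def mass (E : Finset (Sym2 (Site 2))) (x : Site 2) : ℝ :=
  ∑ k : Fin 4, if s(x, x + dir k) ∈ E then (1 : ℝ) else wExt

/-- The weight `w(γ) := m_{γ_n}⁻¹ ∏_{s<n} (w_{γ_sγ_{s+1}} / m_{γ_s}) = ∏_{s ≤ n} m_{γ_s}⁻¹` of a
nearest-neighbour path `γ = (γ_0 ∼ γ_1 ∼ ⋯ ∼ γ_n)` of the domain `Ω = ⟨E⟩` (CDH16 display (3.1); Chelkak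
2016, Def. 2.5: `w(γ) = ∏_s w_{u_s u_{s+1}} / ∏_s μ_{u_s}`; all edges of `𝓔(Ω)` have conductance `1`) —
the probability that the random walk with generator `Δ_Ω` started at `γ_0` makes the steps of `γ`, divided
by the mass of the endpoint. [cite: ChelkakDuminilCopinHongler2016, §3.1; Chelkak2016, Def. 2.5] -/
def walkWeight (E : Finset (Sym2 (Site 2))) {x y : ↥((verts E : Finset (Site 2)) : Set (Site 2))}
    (p : (graph E).Walk x y) : ℝ :=
  (p.support.map fun u => (mass E u.1)⁻¹).prod

/-- **The random-walk partition function** `Z_Ω[x,y] := Σ_{γ ∈ S_Ω(x,y)} w(γ)` of the discrete domain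
`Ω = ⟨E⟩` between two of its vertices (CDH16 §3.1, display (3.1); Chelkak 2016, Def. 2.5): the sum of the
weights of all nearest-neighbour paths of `Ω` from `x` to `y` (paths of the graph `DiscreteRect.graph E` on
the vertex set of `Ω`; `S_Ω(x,y)` = paths whose inner vertices lie in `Ω`), as an extended nonnegative
real. With the conductances `w_ext` on the external edges this is the Green function of CDH16's random
walk on `Ω̄` killed on `∂_ext Ω`, divided by `m_y`; for a boundary arc `A`, `Z_Ω[x, A_ext]` is
`(2√2 + 1)⁻¹ ×` the harmonic measure of `A_ext` seen from `x` (CDH16 Rem. 3.3).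
[cite: ChelkakDuminilCopinHongler2016, §3.1 display (3.1); Chelkak2016, Def. 2.5] -/
def rwZ (E : Finset (Sym2 (Site 2))) (x y : ↥((verts E : Finset (Site 2)) : Set (Site 2))) : ℝ≥0∞ :=
  ∑' p : (graph E).Walk x y, ENNReal.ofReal (walkWeight E p)

/-- `Z_Ω[X,Y] := Σ_{x ∈ X, y ∈ Y} Z_Ω[x,y]` for two sets of vertices of `Ω` (CDH16 §3.1: "For
`X, Y ⊂ Ω̄`, define `Z_Ω[X,Y] := Σ_{x ∈ X, y ∈ Y} Z_Ω[x,y]`"; Chelkak 2016, Def. 2.5), e.g. the two arcs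
`(ab) = {x | x.1 ∈ arcVerts E d₀ n 0}`, `(cd) = {x | x.1 ∈ arcVerts E d₀ n 2}` of a topological rectangle.
[cite: ChelkakDuminilCopinHongler2016, §3.1] -/
def rwZSets (E : Finset (Sym2 (Site 2))) (X Y : Set ↥((verts E : Finset (Site 2)) : Set (Site 2))) :
    ℝ≥0∞ :=
  ∑' x : X, ∑' y : Y, rwZ E x y

/-! ### Elementary properties -/

/-- `w_ext = 2(√2 - 1) > 0`. [cite: ChelkakDuminilCopinHongler2016, §3.1] -/
theorem wExt_pos : 0 < wExt := by
  have : (1 : ℝ) < Real.sqrt 2 := by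
    rw [show (1 : ℝ) = Real.sqrt 1 by simp]
    exact Real.sqrt_lt_sqrt (by norm_num) (by norm_num)
  unfold wExt; linarith

/-- `w_ext = 2(√2 - 1) < 1`: the external edges conduct less than the edges of `Ω`.
[cite: ChelkakDuminilCopinHongler2016, §3.1] -/
theorem wExt_lt_one : wExt < 1 := by
  have h : Real.sqrt 2 < 3 / 2 := by
    rw [show (3 / 2 : ℝ) = Real.sqrt (9 / 4) by
      rw [show (9 / 4 : ℝ) = (3 / 2) ^ 2 by norm_num, Real.sqrt_sq (by norm_num)]]
    exact Real.sqrt_lt_sqrt (by norm_num) (by norm_num)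
  unfold wExt; linarith

/-- `m_ext = 2√2 + 1 > 0`. [cite: ChelkakDuminilCopinHongler2016, §3.1] -/
theorem mExt_pos : 0 < mExt := by
  unfold mExt; positivity

/-- `m_ext = w_ext + 3` ("the notation `m_x = 2(√2 - 1) + 3` for `x ∈ ∂_ext Ω`").
[cite: ChelkakDuminilCopinHongler2016, §3.1] -/
theorem mExt_eq : mExt = wExt + 3 := by
  unfold mExt wExt; ring

/-- `m_x ≤ 4` (four directions of conductance at most `1`). [cite: ChelkakDuminilCopinHongler2016, §3.1] -/
theorem mass_le_four (E : Finset (Sym2 (Site 2))) (x : Site 2) : mass E x ≤ 4 := by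
  unfold mass
  calc ∑ k : Fin 4, (if s(x, x + dir k) ∈ E then (1 : ℝ) else wExt) ≤ ∑ _k : Fin 4, (1 : ℝ) :=
        Finset.sum_le_sum fun k _ => by split_ifs <;> [exact le_rfl; exact wExt_lt_one.le]
    _ = 4 := by simp

/-- `4 w_ext ≤ m_x` (four directions of conductance at least `w_ext`).
[cite: ChelkakDuminilCopinHongler2016, §3.1] -/
theorem four_mul_wExt_le_mass (E : Finset (Sym2 (Site 2))) (x : Site 2) : 4 * wExt ≤ mass E x := by
  unfold mass
  calc 4 * wExt = ∑ _k : Fin 4, wExt := by simp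
    _ ≤ ∑ k : Fin 4, (if s(x, x + dir k) ∈ E then (1 : ℝ) else wExt) :=
        Finset.sum_le_sum fun k _ => by split_ifs <;> [exact wExt_lt_one.le; exact le_rfl]

/-- Masses are positive. [cite: ChelkakDuminilCopinHongler2016, §3.1] -/
theorem mass_pos (E : Finset (Sym2 (Site 2))) (x : Site 2) : 0 < mass E x :=
  lt_of_lt_of_le (by have := wExt_pos; positivity) (four_mul_wExt_le_mass E x)

/-- The number of edges of `E` at `x` in terms of the mass: `m_x = deg_x + w_ext (4 - deg_x)`, i.e. every
edge of `𝓔(Ω)` at `x` raises the mass by `1 - w_ext` above `4 w_ext`. [cite: ChelkakDuminilCopinHongler2016, §3.1] -/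
theorem mass_eq_card_filter (E : Finset (Sym2 (Site 2))) (x : Site 2) :
    mass E x = 4 * wExt + (1 - wExt) * #{k : Fin 4 | s(x, x + dir k) ∈ E} := by
  unfold mass
  rw [Finset.card_filter, Nat.cast_sum, Finset.mul_sum]
  have h4 : (4 : ℝ) * wExt = ∑ _k : Fin 4, wExt := by simp
  rw [h4, ← Finset.sum_add_distrib]
  refine Finset.sum_congr rfl fun k _ => ?_
  split_ifs <;> push_cast <;> ring

/-- Path weights are positive. [cite: ChelkakDuminilCopinHongler2016, §3.1] -/
theorem walkWeight_pos {x y : ↥((verts E : Finset (Site 2)) : Set (Site 2))} (p : (graph E).Walk x y) :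
    0 < walkWeight E p := by
  unfold walkWeight
  apply List.prod_pos
  intro a ha
  obtain ⟨u, -, rfl⟩ := List.mem_map.1 ha
  exact inv_pos.2 (mass_pos E u.1)

/-- The trivial path at `x` has weight `m_x⁻¹`. [cite: ChelkakDuminilCopinHongler2016, §3.1] -/
@[simp] theorem walkWeight_nil (x : ↥((verts E : Finset (Site 2)) : Set (Site 2))) :
    walkWeight E (Walk.nil : (graph E).Walk x x) = (mass E x.1)⁻¹ := by
  simp [walkWeight]

/-- Prepending a step multiplies the weight by `m_x⁻¹` (`= w_{xy}/m_x` with `w_{xy} = 1`: the transition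
probability of the step). [cite: ChelkakDuminilCopinHongler2016, §3.1] -/
@[simp] theorem walkWeight_cons {x y z : ↥((verts E : Finset (Site 2)) : Set (Site 2))}
    (h : (graph E).Adj x y) (p : (graph E).Walk y z) :
    walkWeight E (Walk.cons h p) = (mass E x.1)⁻¹ * walkWeight E p := by
  simp [walkWeight]

/-- The weight of a path is invariant under reversal. [cite: ChelkakDuminilCopinHongler2016, §3.1] -/
@[simp] theorem walkWeight_reverse {x y : ↥((verts E : Finset (Site 2)) : Set (Site 2))}
    (p : (graph E).Walk x y) : walkWeight E p.reverse = walkWeight E p := by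
  simp only [walkWeight, Walk.support_reverse, List.map_reverse, List.prod_reverse]

/-- **Symmetry** `Z_Ω[x,y] = Z_Ω[y,x]` (CDH16 §3.1: "This definition is useful in order to have a
symmetric notation for `Z_Ω[x,y] = Z_Ω[y,x]`"): reversal of paths is a weight-preserving bijection.
[cite: ChelkakDuminilCopinHongler2016, §3.1] -/
theorem rwZ_comm (E : Finset (Sym2 (Site 2))) (x y : ↥((verts E : Finset (Site 2)) : Set (Site 2))) :
    rwZ E x y = rwZ E y x := by
  unfold rwZ
  have hinj : Function.Injective (Walk.reverse : (graph E).Walk y x → (graph E).Walk x y) :=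
    fun p q h => by simpa using congrArg Walk.reverse h
  rw [← hinj.tsum_eq (f := fun p => ENNReal.ofReal (walkWeight E p)) fun p _ =>
    ⟨p.reverse, Walk.reverse_reverse p⟩]
  exact tsum_congr fun p => by simp only [walkWeight_reverse]

/-- The trivial path contributes `m_x⁻¹ ≤ Z_Ω[x,x]`; in particular `Z_Ω[x,x] ≥ 1/4 > 0`.
[cite: ChelkakDuminilCopinHongler2016, §3.1] -/
theorem ofReal_inv_mass_le_rwZ_self (E : Finset (Sym2 (Site 2)))
    (x : ↥((verts E : Finset (Site 2)) : Set (Site 2))) : ENNReal.ofReal (mass E x.1)⁻¹ ≤ rwZ E x x := by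
  unfold rwZ
  calc ENNReal.ofReal (mass E x.1)⁻¹ = ENNReal.ofReal (walkWeight E (Walk.nil : (graph E).Walk x x)) := by
        rw [walkWeight_nil]
    _ ≤ _ := ENNReal.le_tsum (Walk.nil)

/-- `Z_Ω[x,x] ≥ 1/4`. [cite: ChelkakDuminilCopinHongler2016, §3.1] -/
theorem rwZ_self_ge (E : Finset (Sym2 (Site 2))) (x : ↥((verts E : Finset (Site 2)) : Set (Site 2))) :
    ENNReal.ofReal (1 / 4) ≤ rwZ E x x := by
  refine le_trans (ENNReal.ofReal_le_ofReal ?_) (ofReal_inv_mass_le_rwZ_self E x)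
  rw [one_div]
  exact inv_anti₀ (mass_pos E x.1) (mass_le_four E x.1)

/-- A single term of `Z_Ω[X,Y]`. [cite: ChelkakDuminilCopinHongler2016, §3.1] -/
theorem rwZ_le_rwZSets {X Y : Set ↥((verts E : Finset (Site 2)) : Set (Site 2))}
    {x y : ↥((verts E : Finset (Site 2)) : Set (Site 2))} (hx : x ∈ X) (hy : y ∈ Y) :
    rwZ E x y ≤ rwZSets E X Y := by
  unfold rwZSets
  have h1 : rwZ E x y ≤ ∑' y' : Y, rwZ E x y' :=
    ENNReal.le_tsum (f := fun y' : Y => rwZ E x y') ⟨y, hy⟩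
  have h2 : (∑' y' : Y, rwZ E x y') ≤ ∑' x' : X, ∑' y' : Y, rwZ E x' y' :=
    ENNReal.le_tsum (f := fun x' : X => ∑' y' : Y, rwZ E x' y') ⟨x, hx⟩
  exact h1.trans h2

/-- `Z_Ω[X,Y] = Z_Ω[Y,X]`. [cite: ChelkakDuminilCopinHongler2016, §3.1] -/
theorem rwZSets_comm (E : Finset (Sym2 (Site 2))) (X Y : Set ↥((verts E : Finset (Site 2)) : Set (Site 2))) :
    rwZSets E X Y = rwZSets E Y X := by
  unfold rwZSets
  rw [ENNReal.tsum_comm]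
  exact tsum_congr fun y => tsum_congr fun x => rwZ_comm E x y

/-- `Z_Ω[X,Y]` as a finite double sum (the vertex set of `Ω` is finite). [cite: ChelkakDuminilCopinHongler2016, §3.1] -/
theorem rwZSets_eq_sum (E : Finset (Sym2 (Site 2))) (X Y : Set ↥((verts E : Finset (Site 2)) : Set (Site 2)))
    [DecidablePred (· ∈ X)] [DecidablePred (· ∈ Y)] :
    rwZSets E X Y = ∑ x ∈ Finset.univ.filter (· ∈ X), ∑ y ∈ Finset.univ.filter (· ∈ Y), rwZ E x y := by
  have inner : ∀ x, ∑' y : Y, rwZ E x y = ∑ y ∈ Finset.univ.filter (· ∈ Y), rwZ E x y := by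
    intro x
    rw [tsum_subtype Y (fun y => rwZ E x y), tsum_fintype, Finset.sum_filter]
    exact Finset.sum_congr rfl fun y _ => Set.indicator_apply Y (fun y => rwZ E x y) y
  unfold rwZSets
  rw [tsum_subtype X (fun x => ∑' y : Y, rwZ E x y), tsum_fintype, Finset.sum_filter]
  refine Finset.sum_congr rfl fun x _ => ?_
  rw [Set.indicator_apply]
  split_ifs with hx
  · exact inner x
  · rfl

/-! ### The partition function on the completed graph `Ω̄ = Ω ∪ ∂_ext Ω` -/

open scoped Classical in
/-- **CDH16's partition function `Z_Ω[x,y]` for `x, y ∈ Ω̄`** (CDH16 §3.1, display (3.1): "`S_Ω(x,y)` … the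
first and/or last vertices can possibly be on `∂_ext Ω`, in this case `γ_0 ∼ γ_1`, `γ_{n-1} ∼ γ_n` should be
understood as `γ_1γ_0, γ_{n-1}γ_n ∈ 𝓔_ext(Ω)`"), on the vertex type `Site 2 ⊕ (Site 2 × Fin 4)` of the
completed graph `DiscreteRect.extGraph E` (lattice vertices `inl x`, one external vertex `inr d` per external
dart `d`). An external vertex `x_ext = inr (x, k)` has the single edge `x x_ext` of conductance
`w_ext = 2(√2 - 1)` and mass `m_ext = 2√2 + 1`, and the inner vertices of a path of `S_Ω` lie in `Ω`, so a path
from `x_ext` is its external edge followed by a path of `Ω` from `x`: each external endpoint contributes the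
factor `w_ext / m_ext` in (3.1) (`Z_Ω[x_ext, y] = (w_ext/m_ext) Z_Ω[x, y]`,
`Z_Ω[x_ext, y_ext] = (w_ext/m_ext)² Z_Ω[x, y]`, plus the one-vertex path `m_ext⁻¹` when `x_ext = y_ext`);
arguments that are not vertices of `Ω̄` (a lattice point outside `Ω`, a dart that is not external) give `0`.
[cite: ChelkakDuminilCopinHongler2016, §3.1 display (3.1) and Rem. 3.3; Chelkak2016, Def. 2.5] -/
def rwZbar (E : Finset (Sym2 (Site 2))) : Site 2 ⊕ (Site 2 × Fin 4) → Site 2 ⊕ (Site 2 × Fin 4) → ℝ≥0∞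
  | .inl x, .inl y => if h : x ∈ verts E ∧ y ∈ verts E then rwZ E ⟨x, h.1⟩ ⟨y, h.2⟩ else 0
  | .inr d, .inl y =>
      if h : IsExtDart E d ∧ y ∈ verts E then ENNReal.ofReal (wExt / mExt) * rwZ E ⟨d.1, h.1.1⟩ ⟨y, h.2⟩ else 0
  | .inl x, .inr d =>
      if h : x ∈ verts E ∧ IsExtDart E d then ENNReal.ofReal (wExt / mExt) * rwZ E ⟨x, h.1⟩ ⟨d.1, h.2.1⟩ else 0
  | .inr d, .inr d' =>
      if h : IsExtDart E d ∧ IsExtDart E d' then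
        ENNReal.ofReal (wExt / mExt) ^ 2 * rwZ E ⟨d.1, h.1.1⟩ ⟨d'.1, h.2.1⟩ +
          (if d = d' then ENNReal.ofReal mExt⁻¹ else 0)
      else 0

/-- `Z_Ω[X,Y] := Σ_{x ∈ X, y ∈ Y} Z_Ω[x,y]` for `X, Y ⊂ Ω̄` (CDH16 §3.1), e.g. two external arcs
`DiscreteRect.extArc E d₀ n j`. [cite: ChelkakDuminilCopinHongler2016, §3.1] -/
def rwZbarSets (E : Finset (Sym2 (Site 2))) (X Y : Set (Site 2 ⊕ (Site 2 × Fin 4))) : ℝ≥0∞ :=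
  ∑' x : X, ∑' y : Y, rwZbar E x y

/-- On vertices of `Ω` the completed partition function is `Z_Ω[x,y]`. [cite: ChelkakDuminilCopinHongler2016, §3.1] -/
theorem rwZbar_inl_inl (x y : ↥((verts E : Finset (Site 2)) : Set (Site 2))) :
    rwZbar E (.inl x.1) (.inl y.1) = rwZ E x y := by
  simp [rwZbar]

/-- `Z_Ω[x_ext, y] = (w_ext/m_ext) Z_Ω[x,y]` (cf. CDH16 (3.3)). [cite: ChelkakDuminilCopinHongler2016, §3.1] -/
theorem rwZbar_inr_inl {d : Site 2 × Fin 4} (hd : IsExtDart E d) (y : ↥((verts E : Finset (Site 2)) : Set (Site 2))) :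
    rwZbar E (.inr d) (.inl y.1) = ENNReal.ofReal (wExt / mExt) * rwZ E ⟨d.1, hd.1⟩ y := by
  simp [rwZbar, hd]

/-- `Z_Ω[x, y_ext] = (w_ext/m_ext) Z_Ω[x,y]`. [cite: ChelkakDuminilCopinHongler2016, §3.1] -/
theorem rwZbar_inl_inr (x : ↥((verts E : Finset (Site 2)) : Set (Site 2))) {d : Site 2 × Fin 4} (hd : IsExtDart E d) :
    rwZbar E (.inl x.1) (.inr d) = ENNReal.ofReal (wExt / mExt) * rwZ E x ⟨d.1, hd.1⟩ := by
  simp [rwZbar, hd]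

/-- `Z_Ω[x_ext, y_ext] = (w_ext/m_ext)² Z_Ω[x,y]` for distinct external vertices.
[cite: ChelkakDuminilCopinHongler2016, §3.1] -/
theorem rwZbar_inr_inr {d d' : Site 2 × Fin 4} (hd : IsExtDart E d) (hd' : IsExtDart E d') (hne : d ≠ d') :
    rwZbar E (.inr d) (.inr d') = ENNReal.ofReal (wExt / mExt) ^ 2 * rwZ E ⟨d.1, hd.1⟩ ⟨d'.1, hd'.1⟩ := by
  simp [rwZbar, hd, hd', hne]

/-- **Symmetry** `Z_Ω[x,y] = Z_Ω[y,x]` on `Ω̄`. [cite: ChelkakDuminilCopinHongler2016, §3.1] -/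
theorem rwZbar_comm (E : Finset (Sym2 (Site 2))) (u v : Site 2 ⊕ (Site 2 × Fin 4)) :
    rwZbar E u v = rwZbar E v u := by
  rcases u with x | d <;> rcases v with y | d'
  · by_cases hx : x ∈ verts E
    · by_cases hy : y ∈ verts E
      · simp only [rwZbar, hx, hy, and_self, dite_true]
        exact rwZ_comm E _ _
      · simp [rwZbar, hx, hy]
    · simp [rwZbar, hx]
  · by_cases hx : x ∈ verts E
    · by_cases hd : IsExtDart E d'
      · simp only [rwZbar, hx, hd, and_self, dite_true]
        rw [rwZ_comm]
      · simp [rwZbar, hd]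
    · simp [rwZbar, hx]
  · by_cases hy : y ∈ verts E
    · by_cases hd : IsExtDart E d
      · simp only [rwZbar, hy, hd, and_self, dite_true]
        rw [rwZ_comm]
      · simp [rwZbar, hd]
    · simp [rwZbar, hy]
  · by_cases hd : IsExtDart E d
    · by_cases hd' : IsExtDart E d'
      · simp only [rwZbar, hd, hd', and_self, dite_true]
        rw [rwZ_comm]
        by_cases hdd : d = d'
        · subst hdd; rfl
        · rw [if_neg hdd, if_neg (Ne.symm hdd)]
      · simp [rwZbar, hd, hd']
    · simp [rwZbar, hd]

/-- `Z_Ω[X,Y] = Z_Ω[Y,X]` on `Ω̄`. [cite: ChelkakDuminilCopinHongler2016, §3.1] -/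
theorem rwZbarSets_comm (E : Finset (Sym2 (Site 2))) (X Y : Set (Site 2 ⊕ (Site 2 × Fin 4))) :
    rwZbarSets E X Y = rwZbarSets E Y X := by
  unfold rwZbarSets
  rw [ENNReal.tsum_comm]
  exact tsum_congr fun y => tsum_congr fun x => rwZbar_comm E x y

end DiscreteRect

end Literature.Probability.LatticeModels

end
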